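import Summits.CriticalPhenomena.PercolationContinuityZ3.Theorems.SahiMasterFamilyUpperMasterFive
import Summits.CriticalPhenomena.PercolationContinuityZ3.Theorems.SahiMasterFamilyUpperMasterSix
import Summits.CriticalPhenomena.PercolationContinuityZ3.Theorems.SahiMasterFamilyPrincipalCapLeSix

/-!
# The upper master inequality for increasing events, every order `2 ≤ n ≤ 6`

Unit `prim-masterthm-p4` (gen 13; crux anchor stmt-CriticalPhenomena-4575, helper work; memo
`run/shared/lean/prim/prim-masterthm/prim-masterthm-p4/P4-GEN13-REPORT.md` §6/§9).
**Theorem.**  For every finite product of two-point spaces `μ_p` (`p ∈ [0,1]^ι`), every `2 ≤ n ≤ 6` and every `n` increasing events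
`U_0,…,U_{n−1}`:  `E_n(μ_p; 1_{U_0},…,1_{U_{n−1}}) ≤ (n−1)!·(μ_p(⋂_j U_j) − ∏_j μ_p(U_j))`
(Sahi's multilinear functional is dominated by `(n−1)!` times the Harris gap of the whole family).  Order 3 is `E₃ ≤ 2(μ(ABC) − μ(A)μ(B)μ(C))`.
Proof: Sahi's set-partition form `E_n = Φ_n(m)`, `m_B = μ(⋂_{j∈B} U_j)` (`PrincipalCapBeta.sahiE_eq_phiSet`); `m ≥ 0` and `m` is
supermultiplicative under all unions by Harris; and the abstract inequalities `UpperMaster.PhiLeTopGap n` (`n = 2` identity; `3, 4` by hand in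
`…UpperMaster`; `5, 6` by the exact LP certificates of `…UpperMasterFive/Six`, kit j124697).  Conjecturally (`PhiLeTopGap n`) this holds for all `n`;
the 'merge-matching' certificate shape used here provably cannot work from `n = 8` on.
HONEST FRAMING: an UPPER bound on `E_n`; Sahi's conjectured LOWER bound `E_n ≥ 0` (`C_n`) is open in general (proved in this tree on the
principal-cap stratum for `n ≤ 6`, `…PrincipalCapLeSix`).  Axioms standard. [this work]
-/

noncomputable section

open scoped Classical

namespace Summit.CriticalPhenomena.PercolationContinuityZ3.Theorems

namespace UpperMaster

open Finset Function
open Literature.Combinatorics.Sahi2008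
open Literature.Probability.Percolation.DecisionTree (ind ind_nonneg)

/-- `U(2)` — an identity: `Φ_2(β) = β_⊤ − β_0 β_1`. [this work] -/
theorem phiLeTopGap_two : PhiLeTopGap 2 := by
  intro β _ _
  rw [PrincipalCapBeta.phiSet_two, Fin.prod_univ_two]
  norm_num [Nat.factorial]

/-- **`U(n)` for every `2 ≤ n ≤ 6`.** [this work] -/
theorem phiLeTopGap_of_two_le_of_le_six {n : ℕ} (h2 : 2 ≤ n) (h6 : n ≤ 6) : PhiLeTopGap n := by
  interval_cases n
  · exact phiLeTopGap_two
  · exact phiLeTopGap_three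
  · exact phiLeTopGap_four
  · exact phiLeTopGap_five
  · exact phiLeTopGap_six

variable {ι : Type} [Fintype ι]

/-- **Transfer `U(n+1)` ⇒ events.**  If `Φ_{n+1}(β) ≤ n!(β_⊤ − ∏β_i)` for every non-negative supermultiplicative set function, then
`E_{n+1}(μ_p; 1_{U_0},…,1_{U_n}) ≤ n!·(μ_p(⋂ U_j) − ∏ μ_p(U_j))` for increasing events (the moment set function `B ↦ μ_p(⋂_{j∈B} U_j)` is
non-negative and, by Harris, supermultiplicative under all unions). [this work] -/
theorem sahiE_ind_le_top_gap_of_phiLeTopGap {n : ℕ} (h : PhiLeTopGap (n + 1)) (p : ι → unitInterval)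
    (U : Fin (n + 1) → Set (Set ι)) (hU : ∀ j, IsUpperSet (U j)) :
    sahiE (bernoulliWeight p) (n + 1) (fun j => ind (U j)) ≤
      (n.factorial : ℝ) * (ex (bernoulliWeight p) (ind (⋂ j, U j)) - ∏ j, ex (bernoulliWeight p) (ind (U j))) := by
  rw [PrincipalCapBeta.sahiE_eq_phiSet]
  have hm : ∀ B : Finset (Fin (n + 1)),
      ex (bernoulliWeight p) (∏ x ∈ B, ind (U x)) = ex (bernoulliWeight p) (ind (⋂ j ∈ B, U j)) := fun B => by
    rw [PrincipalCapBeta.prod_ind_eq_ind_biInter]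
  have h0 : ∀ B : Finset (Fin (n + 1)), 0 ≤ ex (bernoulliWeight p) (∏ x ∈ B, ind (U x)) := fun B => by
    rw [hm]
    exact ex_nonneg (fun ω => (isFKGMeasure_bernoulliWeight p).nonneg ω) fun ω => ind_nonneg _ ω
  have hsup : ∀ S T : Finset (Fin (n + 1)),
      ex (bernoulliWeight p) (∏ x ∈ S, ind (U x)) * ex (bernoulliWeight p) (∏ x ∈ T, ind (U x)) ≤
        ex (bernoulliWeight p) (∏ x ∈ S ∪ T, ind (U x)) := fun S T => by
    rw [hm, hm, hm, PrincipalCapBeta.biInter_union]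
    exact harris_ex_ind p (PrincipalCapBeta.isUpperSet_biInter S hU) (PrincipalCapBeta.isUpperSet_biInter T hU)
  have key := h (fun B => ex (bernoulliWeight p) (∏ x ∈ B, ind (U x))) h0 hsup
  have eU : (⋂ j ∈ (univ : Finset (Fin (n + 1))), U j) = ⋂ j, U j := by
    ext ω; simp
  have e1 : ex (bernoulliWeight p) (∏ x ∈ (univ : Finset (Fin (n + 1))), ind (U x)) =
      ex (bernoulliWeight p) (ind (⋂ j, U j)) := by
    rw [hm, eU]
  have e2 : ∀ j : Fin (n + 1), ex (bernoulliWeight p) (∏ x ∈ ({j} : Finset (Fin (n + 1))), ind (U x)) =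
      ex (bernoulliWeight p) (ind (U j)) := fun j => by
    rw [prod_singleton]
  simp only [e1, e2, Nat.add_sub_cancel] at key
  exact key

/-- **The upper master inequality for increasing events, orders `2 ≤ n+1 ≤ 6`**:
`E_{n+1}(μ_p; 1_{U_0},…,1_{U_n}) ≤ n!·(μ_p(⋂_j U_j) − ∏_j μ_p(U_j))`. [this work] -/
theorem sahiE_ind_le_top_gap_of_le_six {n : ℕ} (h1 : 1 ≤ n) (h6 : n + 1 ≤ 6) (p : ι → unitInterval)
    (U : Fin (n + 1) → Set (Set ι)) (hU : ∀ j, IsUpperSet (U j)) :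
    sahiE (bernoulliWeight p) (n + 1) (fun j => ind (U j)) ≤
      (n.factorial : ℝ) * (ex (bernoulliWeight p) (ind (⋂ j, U j)) - ∏ j, ex (bernoulliWeight p) (ind (U j))) :=
  sahiE_ind_le_top_gap_of_phiLeTopGap (phiLeTopGap_of_two_le_of_le_six (by omega) h6) p U hU

/-- Order six spelled out: `E_6(μ_p; 1_{U_0},…,1_{U_5}) ≤ 120·(μ_p(⋂ U_j) − ∏ μ_p(U_j))` for increasing events. [this work] -/
theorem sahiE_six_ind_le_top_gap (p : ι → unitInterval) (U : Fin 6 → Set (Set ι)) (hU : ∀ j, IsUpperSet (U j)) :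
    sahiE (bernoulliWeight p) 6 (fun j => ind (U j)) ≤
      120 * (ex (bernoulliWeight p) (ind (⋂ j, U j)) - ∏ j, ex (bernoulliWeight p) (ind (U j))) := by
  have h := sahiE_ind_le_top_gap_of_phiLeTopGap phiLeTopGap_six p U hU
  norm_num [Nat.factorial] at h
  exact h

end UpperMaster

end Summit.CriticalPhenomena.PercolationContinuityZ3.Theorems
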